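import Summits.BirchSwinnertonDyer.BirchSwinnertonDyer.Theorems.EisensteinDepletionAtTwoStarDoorSevenPrints
import Summits.BirchSwinnertonDyer.BirchSwinnertonDyer.Theorems.EisensteinDepletionAtTwoStarOptBSFSigmaNodeSeventeenFree
import HarnessLib

/-!
# Line `star` on crux E1M (stmt-BirchSwinnertonDyer-20341): THE END-STATE DOOR, v14 — E1M `DepletedLambdaLawAtTwoMod` (all levels) from FIVE named
# published facts, BY NAME (lead star-p1 GEN 19; the sorry-free content of Lines/star.lean v14)

GEN 18's door (Theorems/…StarDoorSevenPrints) derived E1M from SEVEN named facts.  GEN 19 removes the two CLASSIFICATION prints in the kernel: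
* `Setzer1975_primeConductor_rationalTwoTorsion` entered only the `+256`/`α = −34` branch (`Δ(W₀) = 3⁴·5⁴`); there `3` and `5` divide the minimal discriminant,
  so both are bad primes and `15 ∣ N` — `SigmaNode.false_of_fifteenShape_free` (Theorems/…SigmaNodeFifteenFree);
* `Cremona1997_conductor_seventeen_classification` entered only the `−256`/`α = ±30` branch (`Δ(W₀) = −17⁴`); there `c₆ ≡ −a₁⁶ (mod 4)` kills `α = −30`,
  `α = 30` pins `W₀ ≅ 17a1`, the isogeny `W₀ ~ W` factors as 2-power ∘ odd, the 2-power isogeny class of `17a1` is walked EXPLICITLY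
  (Theorems/…SeventeenModels, …SeventeenClassWalk), odd isogenies transport the type bits, and the case analysis on the four models ends it —
  `SigmaNode.false_of_seventeenShape_free` (Theorems/…SigmaNodeSeventeenFree).
Hence

  E1M ⇐ { (F) cusp images reduce into the identity component (CES 2003 §6.1.2 / Igusa–Katz–Mazur 12.6 / ATAEC IV.9.1),  Edixhoven 1991 Prop. 2,
          the optimal `Γ₁(N)`-datum (CES 2003 §6.1 / Stevens 1989),  Abbes–Ullmo 1996 Thm A,  unbounded denominators (Calegari–Dimitrov–Tang 2025) }
        — modularity being E1M's own hypothesis; all five are facts about modular parametrisations / modular forms, none is a table or a classification.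

* `starOptB_of_fivePrints` — `StarOptB` (aside item 24445, all levels) from four of the prints + modularity;
* `depletedLambdaLawAtTwoMod_of_fivePrints` — E1M from the five prints.

HONEST FRAMING (Barrier B1): a CONDITIONAL result — E1M is proved only modulo the five named facts (hypotheses), none of which is discharged here.  Nothing here
reads `r_an`; E1M as an ITEM, E1M_NSF, the leaf T-r3₂ and BSD are NOT proved (PARTITION D-0054: none — r_an ≥ 2, axis S0; no S0 motion).  No `sorry`, no definition.
-/

set_option linter.dupNamespace false
set_option autoImplicit false

noncomputable section

open scoped Classical MatrixGroups
open CongruenceSubgroup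
open WeierstrassCurve Literature.NumberTheory.EllipticCurves Literature.NumberTheory.EllipticCurves.Greenberg1999
open Literature.NumberTheory.EllipticCurves.ModularForms

namespace Summit.BirchSwinnertonDyer.BirchSwinnertonDyer.Theorems.DepletionAtTwo.SigmaNode

/-- **`StarOptB` (all levels) from four prints + modularity**: (N256) at all levels (`sigmaNode_of_cuspImageNonsingular`, from (F) + Edixhoven), the squarefree door
(T1) ∧ (T2) ⇒ `SfPositions.starOptBSF_of_positions` with (T2′) from `partnerNotCentre_of_sigmaNode_free` (UBD, Edixhoven only), the non-squarefree door
`NsfDoorPrint.starOptBNSF_of_print` (modularity, `Γ₁`-datum, UBD), glued by cases on `Squarefree N_W`.  CONDITIONAL on the named facts.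
[cite: ConradEdixhovenStein2003, §6.1.2 proof of Lemma 6.1.6 (p. 381)] [cite: Edixhoven1991, Prop. 2] [cite: CalegariDimitrovTang2025, Thm. 1.0.1] [cite: Stevens1989, §2] -/
theorem starOptB_of_fivePrints (hnf : exists_isNewformOf) (hF : gamma1Parametrization_cuspImage_nonsingularReduction)
    (hEd : edixhoven_optimalManinConstant_integral) (hex : exists_optimal_gamma1ParametrizationData)
    (hU : Literature.NumberTheory.Automorphic.CalegariDimitrovTang2025_unboundedDenominators) :
    Summit.BirchSwinnertonDyer.BirchSwinnertonDyer.Theses.EisensteinDepletionAtTwo.StarOptB := by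
  intro W _ _ x hord hx hAB h15 N _ f hf W₀ _ _ hf₀ L₀ hL₀ q hq hin hout
  by_cases hsf : Squarefree (W.conductorNorm ℤ)
  · have hN := sigmaNode_of_cuspImageNonsingular hF hEd
    exact SfPositions.starOptBSF_of_positions (optimalNotTypeA_of_sigmaNode hU hEd hN)
      (MidWalk.optimalNotMidPointed_of_partnerNotCentre (partnerNotCentre_of_sigmaNode_free hU hEd hN))
      W x hord hx hAB h15 hsf f hf W₀ hf₀ L₀ hL₀ q hq hin hout
  · exact NsfDoorPrint.starOptBNSF_of_print hnf hex hU W x hord hx hAB h15 hsf f hf W₀ hf₀ L₀ hL₀ q hq hin hout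

/-- **THE END-STATE DOOR OF LINE `star`, v14: E1M `DepletedLambdaLawAtTwoMod` (item 20341, all conductors) from FIVE named published facts, BY NAME** —
modularity (E1M's own binder) gives `StarGO2Sigma` through line kummer's door (`KummerDoor.starGO2Sigma_of_modularity_abbesUllmo_ubd`: Abbes–Ullmo, UBD) and
`StarOptB` through `starOptB_of_fivePrints`; the Σ-glue `depletedLambdaLawAtTwoMod_of_starGO2Sigma` concludes.  CONDITIONAL on the five facts; E1M as an item /
BSD NOT proved. [cite: GreenbergVatsal2000, §3 Thm. (3.12), display (28)] [cite: ConradEdixhovenStein2003, §6.1.2 proof of Lemma 6.1.6 (p. 381)]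
[cite: AbbesUllmo1996, Thm. A] [cite: CalegariDimitrovTang2025, Thm. 1.0.1] [cite: Edixhoven1991, Prop. 2] -/
theorem depletedLambdaLawAtTwoMod_of_fivePrints (hF : gamma1Parametrization_cuspImage_nonsingularReduction)
    (hEd : edixhoven_optimalManinConstant_integral) (hex : exists_optimal_gamma1ParametrizationData)
    (hAU : abbesUllmo_not_dvd_maninConstant_of_not_dvd_level)
    (hU : Literature.NumberTheory.Automorphic.CalegariDimitrovTang2025_unboundedDenominators) :
    Summit.BirchSwinnertonDyer.BirchSwinnertonDyer.Theses.EisensteinDepletionAtTwo.DepletedLambdaLawAtTwoMod := by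
  intro hmod
  have hnf : exists_isNewformOf := hmod
  exact depletedLambdaLawAtTwoMod_of_starGO2Sigma (KummerDoor.starGO2Sigma_of_modularity_abbesUllmo_ubd hnf hAU hU)
    (starOptB_of_fivePrints hnf hF hEd hex hU) hmod

end Summit.BirchSwinnertonDyer.BirchSwinnertonDyer.Theorems.DepletionAtTwo.SigmaNode

end
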